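import Mathlib
import Literature.Analysis.FluidPDE.StatisticalSolution
import Literature.Analysis.FluidPDE.LerayHopf
import Literature.Analysis.FunctionSpaces.TorusTrigPoly
import Literature.Analysis.FunctionSpaces.TorusCalculus
import Summits.AnomalousDissipation.AnomalousDissipation.Theses.MomentParity

/-!
# Crux UniformResolution — ideator 3, round 1: first lemmas of two lines (statements only)

* `GalerkinKHMInstance`, `GalerkinKHM` — line A (galerkin-khm-defect-flux): the Kármán–Howarth–Monin
  identity is EXACT for every level-`N` measure that is 3-stationary in the crux's sense (velocity
  increments commute with the Galerkin projection, so the second-difference field `δ_{-r}δ_r u` is an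
  admissible band-limited quadratic test); weak-in-`r` form = statistical Duchon–Robert identity.
* `HalfHolderEnergyEquality` — line B (leray-half-holder-energy-pincer): a Leray–Hopf solution whose
  kinetic energy is ½-Hölder in time satisfies the energy EQUALITY (Scheffer/Leray: singular times are
  `H^{1/2}`-null; a ½-Hölder BV function cannot charge an `H^{1/2}`-null compact set).
-/

namespace Summit.AnomalousDissipation.AnomalousDissipation.Cruxes.UniformResolution.Ideator3

open MeasureTheory Filter Set
open scoped InnerProductSpace RealInnerProductSpace ENNReal
open Literature.Analysis.FunctionSpaces.Torus Literature.Analysis.FunctionSpaces.EuclideanSpace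
open Literature.Analysis.FluidPDE.Torus UnitAddTorus

local notation "T3" => UnitAddTorus (Fin 3)
local notation "E3" => EuclideanSpace ℝ (Fin 3)
local notation "H3" => Literature.Analysis.FunctionSpaces.Torus.energySpace (Fin 3)

/-- Velocity increment `δ_r v (x) = v (x + r) - v x`. -/
def incr (r : T3) (v : T3 → E3) : T3 → E3 := fun x => v (x + r) - v x

/-- Second-difference test field `w_r = δ_{-r} δ_r v : x ↦ 2 v x - v (x + r) - v (x - r)`. -/
def secondDiff (r : T3) (v : T3 → E3) : T3 → E3 := fun x => (2 : ℝ) • v x - v (x + r) - v (x - r)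

/-- `μ` is carried by level-`N` Fourier–Galerkin fields (crux clause, verbatim). -/
def IsLevel (N : ℕ) (μ : Measure H3) : Prop :=
  ∀ᵐ u ∂μ, ∀ k ∉ (freqBall N).erase (0 : Fin 3 → ℤ),
    mFourierCoeff (complexify ∘ (u.1 : T3 → E3)) k = 0

/-- The crux's `d`-stationarity clause at `d = 3` (all polynomial cylindrical band-limited tests of
degree ≤ 2), verbatim body. -/
def IsThreeStationary (ν : ℝ) (f : T3 → E3) (N : ℕ) (μ : Measure H3) : Prop :=
  ∀ (m : ℕ) (g : Fin m → T3 → E3) (P : MvPolynomial (Fin m) ℝ),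
    (∀ i, (IsSmooth (g i) ∧ IsDivFree (g i) ∧ HasZeroMean (g i) ∧
      (∀ k ∉ (freqBall N).erase (0 : Fin 3 → ℤ), mFourierCoeff (complexify ∘ (g i)) k = 0))) →
    P.totalDegree + 1 ≤ 3 →
      Integrable (fun u => nsGeneratorPairing ν f u (fun x => ∑ i : Fin m,
        (MvPolynomial.eval (fun j => pairing u.1 (g j)) (MvPolynomial.pderiv i P)) • g i x)) μ ∧
      ∫ u, nsGeneratorPairing ν f u (fun x => ∑ i : Fin m,
        (MvPolynomial.eval (fun j => pairing u.1 (g j)) (MvPolynomial.pderiv i P)) • g i x) ∂μ = 0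

/-- LINE A, first lemma (pointwise-in-`r` form): for a level-`N`, boundedly supported, 3-stationary
measure, testing stationarity with the quadratic observable `½‖δ_r u‖²` (whose gradient is the
band-limited field `δ_{-r}δ_r u`) gives the EXACT Galerkin Kármán–Howarth–Monin balance
`ν⟨‖∇δ_r u‖²⟩ = ⟨(δ_r f, δ_r u)⟩ + ⟨∫ (u ⊗ u) : ∇(δ_{-r}δ_r u)⟩` — no projection commutator. -/
def GalerkinKHMInstance : Prop :=
  ∀ (ν : ℝ) (f : T3 → E3), IsSmooth f → IsDivFree f → HasZeroMean f →
  ∀ (N : ℕ) (R : ℝ) (μ : Measure H3), IsProbabilityMeasure μ → IsLevel N μ →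
    (∀ᵐ u ∂μ, ‖u‖ ≤ R) → IsThreeStationary ν f N μ →
  ∀ r : T3,
    ν * ∫ u, (eGradNormSq (incr r (u.1 : T3 → E3))).toReal ∂μ =
      (∫ u, (∫ x, ⟪f (x + r) - f x, incr r (u.1 : T3 → E3) x⟫_ℝ) ∂μ) +
        ∫ u, inertialPairing u.1 (secondDiff r (u.1 : T3 → E3)) ∂μ

/-- LINE A, first lemma (weak-in-`r` = statistical Duchon–Robert form): integrating the instance
against a smooth `φ(r)` and using `∫ δ_r u · δ_r((u·∇)u) dx = ½ ∇_r · ∫ δ_r u |δ_r u|² dx`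
(periodicity + incompressibility only), the inertial term becomes a third-order absolute-free
structure function with NO derivative on `u`:
`ν ∫ φ ⟨‖∇δ_r u‖²⟩ dr = ∫ φ ⟨(δ_r f, δ_r u)⟩ dr + ½ ∫ ⟨∫ (∇φ(r)·δ_r u(x)) |δ_r u(x)|² dx⟩ dr`. -/
def GalerkinKHM : Prop :=
  ∀ (ν : ℝ) (f : T3 → E3), IsSmooth f → IsDivFree f → HasZeroMean f →
  ∀ (N : ℕ) (R : ℝ) (μ : Measure H3), IsProbabilityMeasure μ → IsLevel N μ →
    (∀ᵐ u ∂μ, ‖u‖ ≤ R) → IsThreeStationary ν f N μ →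
  ∀ φ : T3 → ℝ, IsSmooth φ →
    ν * ∫ r, φ r * (∫ u, (eGradNormSq (incr r (u.1 : T3 → E3))).toReal ∂μ) =
      (∫ r, φ r * (∫ u, (∫ x, ⟪f (x + r) - f x, incr r (u.1 : T3 → E3) x⟫_ℝ) ∂μ)) +
        2⁻¹ * ∫ r, (∫ u, (∫ x,
          ⟪Literature.Analysis.FunctionSpaces.Torus.gradient φ r, incr r (u.1 : T3 → E3) x⟫_ℝ *
            ‖incr r (u.1 : T3 → E3) x‖ ^ 2) ∂μ)

/-- LINE B, first lemma (deterministic pincer): a global Leray–Hopf solution of NS_ν on `T³` with a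
smooth steady force whose kinetic energy `t ↦ ½‖u(t)‖²` is ½-Hölder on `[a, b]` (`0 < a`) satisfies
the energy EQUALITY on `[a, b]`.  Proof sketch: the defect measure
`D = (f,u) dt − ν‖∇u‖² dt − d(½‖u‖²) ≥ 0` is supported on the singular-time set `Σ`, which is compact
with `H^{1/2}(Σ) = 0` (Leray 1934 / Scheffer 1976; RRS 2016 Thm 8.13); cover `Σ ∩ [a,b]` by intervals
with `∑ |I_i|^{1/2} < η`: `D(Σ) ≤ ∫_{∪ I_i} |(f,u) − ν‖∇u‖²| + [e]_{1/2} η → 0`. -/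
def HalfHolderEnergyEquality : Prop :=
  ∀ (ν : ℝ), 0 < ν → ∀ (f : T3 → E3), IsSmooth f → IsDivFree f → HasZeroMean f →
  ∀ (u₀ : T3 → E3) (u : ℝ → T3 → E3), IsGlobalLerayHopf ν (fun _ => f) u₀ u →
  ∀ (a b C : ℝ), 0 < a → a ≤ b →
    (∀ s ∈ Icc a b, ∀ t ∈ Icc a b,
      |kineticEnergy (u t) - kineticEnergy (u s)| ≤ C * |t - s| ^ ((1 : ℝ) / 2)) →
    kineticEnergy (u b) + ν * (∫⁻ τ in Ioo a b, eGradNormSq (u τ)).toReal =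
      kineticEnergy (u a) + ∫ τ in a..b, ∫ x, ⟪f x, u τ x⟫_ℝ

/-- Sanity: the crux decl is in scope (the lines must conclude it BY NAME in crux-plan). -/
example : Prop := Summit.AnomalousDissipation.AnomalousDissipation.Theses.MomentParity.UniformResolution

end Summit.AnomalousDissipation.AnomalousDissipation.Cruxes.UniformResolution.Ideator3
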